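import Summits.BirchSwinnertonDyer.BirchSwinnertonDyer.Theorems.SignedLowerHalvesSmallImageLowerHalfBothSignsRttFloorCert
import Summits.BirchSwinnertonDyer.BirchSwinnertonDyer.Theorems.SignedLowerHalvesKobayashiLowerHalfLargeImageCongruenceShapeBound
import HarnessLib

/-!
# Route `SignedLowerHalves`, crux L `SmallImageLowerHalfBothSigns` (item stmt-BirchSwinnertonDyer-23599), line `rtt_w3` v5:
# the engine ENG HOLDS FOR A BOUNDED CURVE PARTNER (tier «T1b»: ANY congruent curve `A` whose own inequality
# `λ(L^ε_p(A)) ≤ λ(X^ε(A))` is supplied — CM (Pollack–Rubin), unit `L`-value (T1u), or a RANK DONOR `λ(L^ε_p(A)) ≤ rank A(ℚ)`)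

Width seat `bsd-line-slh-p3-w3` g14 under LEAD `cruxlead-stmt-BirchSwinnertonDyer-23599` g3 (cell `bsd-ssimc`); ROUTE-INDEPENDENT
helper (`--supports stmt-BirchSwinnertonDyer-23599`); THEOREMS ONLY — no definition, no named fact, no `sorry`; PER PAIR machinery;
closes nothing class-wide; BSD / crux L are NOT proved by this.

WHY THIS TIER EXISTS. In the one-sided transport of line `rtt_w3` the partner `g = f_A` of a `p`-congruent curve `A` (good at `p`,
`a_p(A) = 0`, `W[p] ≃ A[p]` `Γ_ℚ`-equivariantly) has to supply exactly ONE inequality: `λ(L^ε_p(A)) ≤ λ(X^ε(A))` (analytic ≤ algebraic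
`λ` at the partner). The LEAD's tier T1 takes it from Pollack–Rubin (CM `A`), g13's tier T1u from a unit `L`-value (`λ(L^ε_A) = 0`).
This file isolates the inequality as a HYPOTHESIS SHAPE («partner bound», PB_A: for every newform `g` of `A`, every Pollack pair, every
cyclotomic `(κ, γ)` and every signed dual datum `D_A` of `A`, `lam (kobayashiL ε L⁺ L⁻) ≤ λ(D_A.X)`) and proves ENG / the transport / crux
L's body at the pair from it — so that ANY future source of the partner inequality plugs in by name. The NEW source typed here is the
RANK DONOR of the large-image cell's congruence road (`CongruenceRoad.le_lambdaInvariant_of_le_mordellWeilRank`, p481588 ff.: Kummer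
points inside `Sel^ε` over `ℚ` give `T^{rank A(ℚ)} ∣ char X^ε(A)`, hence `rank A(ℚ) ≤ λ(X^ε(A))` with NO input about `A` beyond
Kobayashi Thm 1.2): a congruent curve `A` with a displayed Mazur–Tate row `(μ, λ)(L^ε_p(A)) = (0, l_A)` and `l_A ≤ rank A(ℚ)`
(displayed independent points) is a partner for crux L at `(W, p)` — the k3-c4 census (MEMO-5 §2.2) set rank-1 partners aside as
«no conclusion» for crux 4 (μ-transfer needs the partner's MC); for crux L's LOWER half in the rtt_w3 frame they DO conclude.

* §1 ★ `partnerLayerLambdaLower_of_boundedCurvePartner` — ENG's body at a bounded curve partner (the unit engine p750944 with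
  `λ(L^ε_A) = 0` replaced by the bound; AN_W for `A` p744056, Kim's `λ`-transfer `hKim`, Kobayashi Thm 1.2 `h12`).
* §2 supplies of the partner bound: `partnerBound_of_lvalue_unit` (T1u is a special case), `partnerBound_of_mazurTateRow_of_le_mordellWeilRank`
  (RANK DONOR: `A`'s row of the parity of `ε` + `l_A ≤ rank A(ℚ)`), `partnerBound_of_mazurTateRow_of_analyticRank_eq_one` (GZK by name).
* §3 `lamTransport_le_of_boundedCurvePartner` and the closures ★ `forall_kobayashiLowerDivisibility_three_of_boundedCurvePartner`
  (`p = 3`, bound for every sign), ★ `…_of_boundedCurvePartner_of_mazurTateRowOdd` (any odd `p`: bound at `ε = −1` + ONE odd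
  Mazur–Tate row of `W`), ★ `…_of_rankDonor_of_mazurTateRowOdd` (records-ready: two displayed rows + displayed rank).

References: [Kobayashi2003] Conjecture (p. 2), Thm. 1.2, 4.1, (3.6), 7.4; [BDKim2009] Cor. 2.13; [GreenbergLNM1716] §3 Lemma 3.1;
[Pollack2003] Prop. 6.9, 6.10, 6.18, Cor. 5.11; [Vatsal1999] (1.6), (1.13); [GreenbergVatsal2000] Prop. (2.4), §3 Rem. 3.4;
[PollackWeston2011MT] §3.1, Thm. 4.1; [KrausOesterle1992] §3 Prop. 3.
-/

set_option autoImplicit false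
-- D-0017: single-problem summit, the namespace repeats the problem name by design.
set_option linter.dupNamespace false
noncomputable section

open scoped Classical MatrixGroups ModularForm BigOperators

open CongruenceSubgroup WeierstrassCurve Field Polynomial NumberField IsDedekindDomain
  Literature.NumberTheory.EllipticCurves Literature.NumberTheory.EllipticCurves.ModularForms
  Literature.NumberTheory.EllipticCurves.Rank1Residual
  Literature.NumberTheory.EllipticCurves.Kobayashi2003
  Literature.NumberTheory.EllipticCurves.GreenbergVatsal2000 ZpExtension
  Literature.NumberTheory.IwasawaTheory Rat.HeightOneSpectrum
  Summit.BirchSwinnertonDyer.Rank1Residual.Supersingular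
  Summit.BirchSwinnertonDyer.Rank1Residual.X1.MuLambda
  Summit.BirchSwinnertonDyer.Rank1Residual.X2.EulerFactorAlgebra
  Summit.BirchSwinnertonDyer.Rank1Residual.X2.EulerFactorInvariants
  Summit.BirchSwinnertonDyer.BirchSwinnertonDyer.Theorems.SmallImageLambdaLowerThreeNsThetaTransport

namespace Summit.BirchSwinnertonDyer.BirchSwinnertonDyer.Theorems.SmallImageRttOneSided

/-! ## §1 ENG for a bounded curve partner -/

section Engine

/-- ★ **The engine stub ENG of line `rtt_w3` HOLDS AT A BOUNDED CURVE PARTNER.** `W` good at the odd `p` with `a_p = 0`; a curve `A`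
good at `p` with `a_p(A) = 0`, `W[p] ≃ A[p]` (`Γ_ℚ`-equivariant); its newform `g = f_A` with a Pollack pair, `ι`, a plus period `Ω`;
cyclotomic `(κ, γ)`; and the PARTNER BOUND at `(κ, γ, ε)`: for every Pollack pair `(L⁺, L⁻)` of `g` and every signed dual datum `D_A`
of `A` (f.g., torsion), `λ(kobayashiL ε L⁺ L⁻) ≤ λ(D_A.X)`. GRANTED BY NAME Kobayashi Thm 1.2 (`h12`) and Kim 2009 Cor 2.13-λ
(`hKim`): for finite `S₀ ∌ p` ⊇ bad(W) ∪ primes(N_A) and a signed dual datum `D` of `W` of sign `ε` (f.g., torsion, `μ = 0`), for all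
`n ≫ 0` of the parity of `ε`: `λ_n(θ^{S₀}_n(g)^ι) ≤ deg ω_n^{−ε} + λ(X^ε_W) + Σ_{v∈S₀} δ_W^{(v)}`. Proof = the unit engine (p750944) with
`λ(L^ε_A) = 0` replaced by the bound: AN_W for `A` (p744056) gives the layer-`λ` as `deg ω_n^{−ε} + λ(L^ε_A) + Σδ_A`, and
`λ(L^ε_A) + Σδ_A ≤ λ(X^ε_A) + Σδ_A = λ(X^ε_W) + Σδ_W`. CONDITIONAL on the two named facts; closes nothing.
[cite: BDKim2009, Cor. 2.13] [cite: Kobayashi2003, Thm. 1.2] [cite: Pollack2003, Prop. 6.18] [cite: GreenbergVatsal2000, §2 Prop. (2.4)] -/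
theorem partnerLayerLambdaLower_of_boundedCurvePartner
    (h12 : thm12_signedSelmerDual_finite_torsion)
    (hKim : BDKim2009.cor213_signedLambda_add_sum_delta_eq_of_torsionIso)
    (W A : WeierstrassCurve ℚ) [W.IsElliptic] [W.IsGloballyMinimal] [A.IsElliptic] [A.IsGloballyMinimal]
    (p : ℕ) [Fact p.Prime] (hp2 : p ≠ 2)
    (hgoodW : W.HasGoodReductionAtPrime p) (hapW : W.frobeniusTrace p = 0)
    (hgoodA : A.HasGoodReductionAtPrime p) (hapA : A.frobeniusTrace p = 0)
    (he : ∃ e : geomTorsion W (p : ℤ) ≃+ geomTorsion A (p : ℤ),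
      ∀ (σ : Field.absoluteGaloisGroup ℚ) (P : geomTorsion W (p : ℤ)), e (σ • P) = σ • e P)
    [NeZero (A.conductorNorm ℤ)] (g : CuspForm (Gamma0 (A.conductorNorm ℤ)) 2) (hg : IsNewformOf A g)
    (ι : coeffField g →+* PadicAlgCl p) (Ω : ℂ) (hΩ : IsPlusPeriod g Ω)
    (hPolA : ∃ Lp Lm : IwasawaAlgebra p, IsPollackPair g p Lp Lm)
    (ε : ℤˣ) (κ : ZpExtension ℚ p) (γ : absoluteGaloisGroup ℚ) (hκ : κ.IsCyclotomic) (hγ : κ.IsTopGenerator γ)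
    (hbound : ∀ (Lp Lm : IwasawaAlgebra p), IsPollackPair g p Lp Lm →
      ∀ (DA : SignedSelmerDualData A κ γ ε) [Module.Finite (IwasawaAlgebra p) DA.X],
        Module.IsTorsion (IwasawaAlgebra p) DA.X → lam (kobayashiL ε Lp Lm) ≤ lambdaInvariant p DA.X)
    (S₀ : Finset (HeightOneSpectrum (𝓞 ℚ))) (hS₀p : ∀ v ∈ S₀, ((p : ℕ) : 𝓞 ℚ) ∉ v.asIdeal)
    (hS₀W : ∀ v : HeightOneSpectrum (𝓞 ℚ), ¬ W.HasGoodReductionAt v → v ∈ S₀)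
    (hS₀A : ∀ v : HeightOneSpectrum (𝓞 ℚ), natGenerator v ∣ A.conductorNorm ℤ → v ∈ S₀)
    (D : SignedSelmerDualData W κ γ ε) [Module.Finite (IwasawaAlgebra p) D.X]
    (hXt : Module.IsTorsion (IwasawaAlgebra p) D.X) (hμ : D.mu = 0) :
    ∃ n₀ : ℕ, ∀ n ≥ n₀, (Even n ↔ ε = 1) →
      ((layerLambda (((mazurTateElementK g Ω p n).map ι *
              ∏ v ∈ S₀, (1 - C (embCoeff g ι (natGenerator v)) * X +
                  (if natGenerator v ∣ A.conductorNorm ℤ then 0 else C (natGenerator v : PadicAlgCl p)) * X ^ 2).comp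
                (C ((natGenerator v : PadicAlgCl p)⁻¹) *
                  (X + 1) ^ (PadicInt.toZModPow n (-(frobeniusExponent p (natGenerator v : ℤ_[p])))).val)) %ₘ
              ((X + 1) ^ p ^ n - 1)) : ℕ) : ℤ) ≤
        ((if ε = 1 then cyclotomicOmegaMinus p n else cyclotomicOmegaPlus p n).natDegree : ℤ) +
          ((lambdaInvariant p D.X : ℕ) : ℤ) + ((∑ v ∈ S₀, delta W p v : ℕ) : ℤ) := by
  obtain ⟨Lp, Lm, hPPA⟩ := hPolA
  -- (1) AN_W for `A`
  have hS' : ∀ v ∈ S₀, natGenerator v ≠ p := fun v hv ↦ natGenerator_ne_of_natCast_not_mem v (hS₀p v hv)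
  obtain ⟨n₁, hn₁⟩ :=
    Summit.BirchSwinnertonDyer.BirchSwinnertonDyer.Theorems.SmallImageRttLayerLaw.eventually_layerLambda_depleted_of_isPollackPair
      A hp2 g hPPA ε S₀ hS'
  -- (2) a signed dual datum of `A` (f.g. torsion by Kobayashi Thm 1.2) and the partner bound there
  obtain ⟨DA⟩ := Kobayashi2003.nonempty_signedSelmerDualData (W := A) (κ := κ) (ε := ε) hγ
  haveI : Module.Finite (IwasawaAlgebra p) DA.X := h12.moduleFinite hp2 hgoodA hapA hκ hγ DA
  have hXtA : Module.IsTorsion (IwasawaAlgebra p) DA.X := h12.isTorsion hp2 hgoodA hapA hκ hγ DA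
  have hlamA : lam (kobayashiL ε Lp Lm) ≤ lambdaInvariant p DA.X := hbound Lp Lm hPPA DA hXtA
  -- (3) Kim's λ-transfer `W ↔ A`
  have hS₀A' : ∀ v : HeightOneSpectrum (𝓞 ℚ), ¬ A.HasGoodReductionAt v → v ∈ S₀ := fun v hv ↦
    hS₀A v ((WeierstrassCurve.dvd_conductorNorm_iff A v).mpr hv)
  have hKimW := hKim W A p hp2 hgoodW hapW hgoodA hapA he κ γ hκ hγ S₀ hS₀p hS₀W hS₀A' ε D DA hXt hXtA hμ
  -- (4) the `g`-side layer element is `C(c)·` the `A`-side one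
  obtain ⟨c, hc0, hθ⟩ := exists_C_mul_map_mazurTateElementK hg.1 hg.coeffField_eq_bot hΩ ι
  have hfac : ∀ v : HeightOneSpectrum (𝓞 ℚ), ∀ n : ℕ, (1 - C (embCoeff g ι (natGenerator v)) * X +
                  (if natGenerator v ∣ A.conductorNorm ℤ then 0 else C (natGenerator v : PadicAlgCl p)) * X ^ 2).comp
                (C ((natGenerator v : PadicAlgCl p)⁻¹) *
                  (X + 1) ^ (PadicInt.toZModPow n (-(frobeniusExponent p (natGenerator v : ℤ_[p])))).val) =
              ((A.localPolynomialAt v).map (Int.castRingHom (PadicAlgCl p))).comp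
                (C ((natGenerator v : PadicAlgCl p)⁻¹) *
                  (X + 1) ^ (PadicInt.toZModPow n (-(frobeniusExponent p (natGenerator v : ℤ_[p])))).val) := by
    intro v n
    rw [partnerEulerFactor_eq A hg ι v]
  refine ⟨n₁, fun n hn hpar ↦ ?_⟩
  have h1 := hn₁ n hn hpar
  have hrew : (((mazurTateElementK g Ω p n).map ι *
              ∏ v ∈ S₀, (1 - C (embCoeff g ι (natGenerator v)) * X +
                  (if natGenerator v ∣ A.conductorNorm ℤ then 0 else C (natGenerator v : PadicAlgCl p)) * X ^ 2).comp
                (C ((natGenerator v : PadicAlgCl p)⁻¹) *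
                  (X + 1) ^ (PadicInt.toZModPow n (-(frobeniusExponent p (natGenerator v : ℤ_[p])))).val)) %ₘ
              ((X + 1) ^ p ^ n - 1)) =
      C c * (((mazurTateElement g p n).map (algebraMap ℚ (PadicAlgCl p)) *
              ∏ v ∈ S₀, ((A.localPolynomialAt v).map (Int.castRingHom (PadicAlgCl p))).comp
                (C ((natGenerator v : PadicAlgCl p)⁻¹) *
                  (X + 1) ^ (PadicInt.toZModPow n (-(frobeniusExponent p (natGenerator v : ℤ_[p])))).val)) %ₘ
              ((X + 1) ^ p ^ n - 1)) := by
    rw [hθ n, Finset.prod_congr rfl (fun v _ ↦ hfac v n), mul_assoc, C_mul', smul_modByMonic, ← C_mul']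
  rw [hrew, Summit.BirchSwinnertonDyer.BirchSwinnertonDyer.Theorems.ResidualThetaLayer.layerLambda_C_mul hc0, h1]
  have hK' : ((lambdaInvariant p D.X : ℕ) : ℤ) + ((∑ v ∈ S₀, delta W p v : ℕ) : ℤ) =
      ((lambdaInvariant p DA.X : ℕ) : ℤ) + ((∑ v ∈ S₀, delta A p v : ℕ) : ℤ) := by
    exact_mod_cast hKimW
  have hle : ((lam (kobayashiL ε Lp Lm) : ℕ) : ℤ) ≤ ((lambdaInvariant p DA.X : ℕ) : ℤ) := by exact_mod_cast hlamA
  push_cast [Nat.cast_add] at hK' ⊢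
  omega

end Engine

/-! ## §2 Supplies of the partner bound -/

section Supplies

variable (A : WeierstrassCurve ℚ) [A.IsElliptic] [A.IsGloballyMinimal] (p : ℕ) [Fact p.Prime]

/-- **Partner bound from a unit `L`-value** (tier T1u is a special case of T1b): `λ(L^ε_p(A)) = 0 ≤ λ(X^ε(A))` for every signed dual
datum, both signs (`lam_kobayashiL_eq_zero_of_lvalue_unit`, p750944; `h5`/`h3` by name). [cite: Kobayashi2003, (3.6) (p. 7)]
[cite: GreenbergVatsal2000, §3, Remark 3.4] -/
theorem partnerBound_of_lvalue_unit
    (h5 : realPeriodRat_eq_unit_mul_plusPeriod) (h3 : realPeriodRat_eq_unit_mul_plusPeriod_three)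
    (hp : p ≠ 2) (hgood : A.HasGoodReductionAtPrime p) (hap : A.frobeniusTrace p = 0)
    {N : ℕ} [NeZero N] {g : CuspForm (Gamma0 N) 2} (hg : IsNewformOf A g)
    {t : ℚ} (ht : A.entireLFunction 1 / (A.realPeriodRat : ℂ) = ((t : ℚ) : ℂ)) (ht0 : t ≠ 0)
    (hvt : padicValRat p t = 0) (ε : ℤˣ) (κ : ZpExtension ℚ p) (γ : absoluteGaloisGroup ℚ) :
    ∀ (Lp Lm : IwasawaAlgebra p), IsPollackPair g p Lp Lm →
      ∀ (DA : SignedSelmerDualData A κ γ ε) [Module.Finite (IwasawaAlgebra p) DA.X],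
        Module.IsTorsion (IwasawaAlgebra p) DA.X → lam (kobayashiL ε Lp Lm) ≤ lambdaInvariant p DA.X := by
  intro Lp Lm hPP DA _ _
  rw [lam_kobayashiL_eq_zero_of_lvalue_unit A p h5 h3 hp hgood hap hg hPP ht ht0 hvt ε]
  exact Nat.zero_le _

/-- **Partner bound of a RANK DONOR from ONE Mazur–Tate row of `A`.** If the Mazur–Tate element `θ_n(g)` of the newform `g` of `A`
at a layer `n` of the parity of `ε` is `= Θ ∈ Λ`, `Θ ≠ 0`, `μ(Θ) = 0`, `λ(Θ) = deg ω_n^{−ε} + l` (displayed row ⇒ `λ(L^ε_p(A)) = l`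
by the b2b certificate theorems, file `…RttFloorCert`), and `l ≤ rank A(ℚ)` (displayed independent points), then
`λ(L^ε_p(A)) ≤ λ(X^ε(A))` for every admissible `(κ, γ)` and every signed dual datum — by the large-image cell's
`CongruenceRoad.le_lambdaInvariant_of_le_mordellWeilRank` (Kummer points: `T^{rank A(ℚ)} ∣ char X^ε(A)`). NO `L`-value, NO CM, NO
main conjecture for `A`. [cite: GreenbergLNM1716, §3 Lemma 3.1] [cite: Pollack2003, Prop. 6.9, Prop. 6.10 and Prop. 6.18]
[cite: Kobayashi2003, Def. 1.1 and Thm. 1.2] -/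
theorem partnerBound_of_mazurTateRow_of_le_mordellWeilRank
    (hp : p ≠ 2) (hgood : A.HasGoodReductionAtPrime p) (hap : A.frobeniusTrace p = 0)
    {N : ℕ} [NeZero N] {g : CuspForm (Gamma0 N) 2} (hg : IsNewformOf A g)
    (ε : ℤˣ) {n : ℕ} (hn : Even n ↔ ε = 1) {Θ : IwasawaAlgebra p}
    (hΘ : iwasawaToPowerSeries p Θ = ((mazurTateElement g p n).map (algebraMap ℚ ℚ_[p]) : PowerSeries ℚ_[p]))
    (hΘ0 : Θ ≠ 0) (hμ : mu Θ = 0) {l : ℕ}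
    (hlam : lam Θ = (if ε = 1 then cyclotomicOmegaMinus p n else cyclotomicOmegaPlus p n).natDegree + l)
    (hr : l ≤ A.mordellWeilRank) :
    ∀ (κ : ZpExtension ℚ p) (γ : absoluteGaloisGroup ℚ), κ.IsCyclotomic → κ.IsTopGenerator γ → IsCyclotomicVariable p γ →
    ∀ (Lp Lm : IwasawaAlgebra p), IsPollackPair g p Lp Lm →
      ∀ (DA : SignedSelmerDualData A κ γ ε) [Module.Finite (IwasawaAlgebra p) DA.X],
        Module.IsTorsion (IwasawaAlgebra p) DA.X → lam (kobayashiL ε Lp Lm) ≤ lambdaInvariant p DA.X := by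
  intro κ γ hκ hγ hγ' Lp Lm hPP DA _ hXtA
  rw [(mu_lam_kobayashiL_of_mazurTateRow hp hg hgood hap ε hn hΘ hΘ0 hμ hlam hPP).2]
  exact CongruenceRoad.le_lambdaInvariant_of_le_mordellWeilRank (p := p) ε hr κ γ hκ hγ hγ' DA hXtA

/-- **Partner bound of an ANALYTIC-RANK-ONE DONOR** (Gross–Zagier–Kolyvagin `hGZK` by name: `rank A(ℚ) = 1`): a row of the parity of `ε`
with `λ(θ_n) = deg ω_n^{−ε} + l`, `l ≤ 1`, gives `λ(L^ε_p(A)) ≤ λ(X^ε(A))`. [cite: GreenbergLNM1716, §3 Lemma 3.1]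
[cite: Pollack2003, Prop. 6.18] [cite: Kobayashi2003, Thm. 1.2] -/
theorem partnerBound_of_mazurTateRow_of_analyticRank_eq_one
    (hGZK : rank_eq_analyticRank_of_analyticRank_le_one)
    (hp : p ≠ 2) (hgood : A.HasGoodReductionAtPrime p) (hap : A.frobeniusTrace p = 0)
    {N : ℕ} [NeZero N] {g : CuspForm (Gamma0 N) 2} (hg : IsNewformOf A g)
    (ε : ℤˣ) {n : ℕ} (hn : Even n ↔ ε = 1) {Θ : IwasawaAlgebra p}
    (hΘ : iwasawaToPowerSeries p Θ = ((mazurTateElement g p n).map (algebraMap ℚ ℚ_[p]) : PowerSeries ℚ_[p]))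
    (hΘ0 : Θ ≠ 0) (hμ : mu Θ = 0) {l : ℕ}
    (hlam : lam Θ = (if ε = 1 then cyclotomicOmegaMinus p n else cyclotomicOmegaPlus p n).natDegree + l)
    (hl : l ≤ 1) (h1 : A.analyticRank = 1) :
    ∀ (κ : ZpExtension ℚ p) (γ : absoluteGaloisGroup ℚ), κ.IsCyclotomic → κ.IsTopGenerator γ → IsCyclotomicVariable p γ →
    ∀ (Lp Lm : IwasawaAlgebra p), IsPollackPair g p Lp Lm →
      ∀ (DA : SignedSelmerDualData A κ γ ε) [Module.Finite (IwasawaAlgebra p) DA.X],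
        Module.IsTorsion (IwasawaAlgebra p) DA.X → lam (kobayashiL ε Lp Lm) ≤ lambdaInvariant p DA.X :=
  partnerBound_of_mazurTateRow_of_le_mordellWeilRank A p hp hgood hap hg ε hn hΘ hΘ0 hμ hlam
    (hl.trans (le_of_eq ((hGZK A (by omega)).1.trans h1).symm))

end Supplies

/-! ## §3 The one-sided transport and crux L's body at a T1b pair -/

section TierBounded

variable (W A : WeierstrassCurve ℚ) [W.IsElliptic] [W.IsGloballyMinimal] [A.IsElliptic] [A.IsGloballyMinimal]
  (p : ℕ) [Fact p.Prime]

/-- **The one-sided transport at a T1b pair, at the sign `ε`, from print** (Kan₂ binder-free p751654 §1 at the partner `f_A`; ENG = §1;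
supply `curvePartner_supply` p751654 §2). The partner bound is asked for EVERY newform `g` of `A` (all have the `q`-expansion of `A`).
CONDITIONAL on the displayed named facts; per pair. [cite: Vatsal1999, Thm. (1.6), (1.13)] [cite: BDKim2009, Cor. 2.13]
[cite: Kobayashi2003, Thm. 1.2] -/
theorem lamTransport_le_of_boundedCurvePartner
    (h12 : thm12_signedSelmerDual_finite_torsion)
    (hD : Hida2000_thm326_exists_galoisRep) (hC : Carayol1986_artinConductorExponent)
    (hS : ∀ (V : WeierstrassCurve ℚ) (ℓ : ℕ) [Fact ℓ.Prime],
      V.swanConductorAt_rationalTate_eq_wildConductorExponent_of_ringChar_eq_two ℓ)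
    (hmod : exists_isNewformOf)
    (hKim : BDKim2009.cor213_signedLambda_add_sum_delta_eq_of_torsionIso) (hV : vatsal1999_plusSymbol_congruence)
    (hp : p ≠ 2) (hX : ClassX7 W p) (hap : W.frobeniusTrace p = 0)
    (hgoodA : A.HasGoodReductionAtPrime p) (hapA : A.frobeniusTrace p = 0)
    (he : ∃ e : geomTorsion W (p : ℤ) ≃+ geomTorsion A (p : ℤ),
      ∀ (σ : absoluteGaloisGroup ℚ) (P : geomTorsion W (p : ℤ)), e (σ • P) = σ • e P)
    (ε : ℤˣ)
    (hbound : ∀ [NeZero (A.conductorNorm ℤ)] (g : CuspForm (Gamma0 (A.conductorNorm ℤ)) 2), IsNewformOf A g →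
      ∀ (κ : ZpExtension ℚ p) (γ : absoluteGaloisGroup ℚ), κ.IsCyclotomic → κ.IsTopGenerator γ → IsCyclotomicVariable p γ →
      ∀ (Lp Lm : IwasawaAlgebra p), IsPollackPair g p Lp Lm →
        ∀ (DA : SignedSelmerDualData A κ γ ε) [Module.Finite (IwasawaAlgebra p) DA.X],
          Module.IsTorsion (IwasawaAlgebra p) DA.X → lam (kobayashiL ε Lp Lm) ≤ lambdaInvariant p DA.X) :
    ∀ (κ : ZpExtension ℚ p) (γ : absoluteGaloisGroup ℚ),
      κ.IsCyclotomic → κ.IsTopGenerator γ → IsCyclotomicVariable p γ →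
      ∀ [NeZero (W.conductorNorm ℤ)] (f : CuspForm (Gamma0 (W.conductorNorm ℤ)) 2),
        IsNewformOf W f → ∀ (ϖ : ℚ), (ϖ : ℝ) * W.realPeriodRat = plusPeriod f →
      ∀ (Lplus Lminus : IwasawaAlgebra p), IsPollackPair f p Lplus Lminus →
        HasUnitContent (kobayashiL ε Lplus Lminus) →
      ∀ (D : SignedSelmerDualData W κ γ ε) [Module.Finite (IwasawaAlgebra p) D.X],
        Module.IsTorsion (IwasawaAlgebra p) D.X → D.mu = 0 →
      ∀ (G : IwasawaAlgebra p) (m : ℕ),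
        iwasawaToPowerSeries p G =
          PowerSeries.C ((p : ℚ_[p]) ^ m * (ϖ : ℚ_[p])) * iwasawaToPowerSeries p (kobayashiL ε Lplus Lminus) →
        lam G ≤ lambdaInvariant p D.X := by
  have hgood : W.HasGoodReductionAtPrime p := hX.1.1
  obtain ⟨iN, g, ι, Ω, hg, hpN, hlev, hnew, hapg, hΩ, hcong, hPol⟩ :=
    curvePartner_supply hD hC hS hmod W A p hp hgoodA hapA he
  intro κ γ hκ hγ hγ' _ f hf ϖ hϖ Lplus Lminus hPP hfl D _ hXt hμ G m hG
  exact lamTransport_le_of_partner W p hp hgood ε g ι Ω hpN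
    (thetaLayerLambda_of_partner hV W p hp hX hap ε (A.conductorNorm ℤ) g ι Ω hpN hlev hnew hapg hΩ.isPlusPeriod hcong)
    (fun κ γ hκ hγ hγ' S₀ hS₀p hS₀W hS₀A D _ hXt hμ ↦
      partnerLayerLambdaLower_of_boundedCurvePartner h12 hKim W A p hp hgood hap hgoodA hapA he g hg ι Ω
        hΩ.isPlusPeriod hPol ε κ γ hκ hγ (hbound g hg κ γ hκ hγ hγ') S₀ hS₀p hS₀W hS₀A D hXt hμ)
    κ γ hκ hγ hγ' f hf ϖ hϖ Lplus Lminus hPP hfl D hXt hμ G m hG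

/-- ★ **TIER T1b AT `p = 3` IS CLOSED MODULO PRINT: crux L's body `∀ ε, KobayashiLowerDivisibility W 3 ε` at every small-image
supersingular X7 pair with a BOUNDED CURVE PARTNER** (the partner bound displayed for BOTH signs), from the eleven published named
facts of tier T1u (no Pollack–Rubin; the floor at `3` is THEOREM B, input-free). Per pair; CONDITIONAL on print; closes nothing class-wide.
[cite: Kobayashi2003, Conjecture (p. 2), Thm. 7.4 (p. 13)] [cite: BDKim2009, Cor. 2.13] [cite: Vatsal1999, Thm. (1.6), (1.13)]
[cite: GreenbergLNM1716, §3 Lemma 3.1] -/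
theorem forall_kobayashiLowerDivisibility_three_of_boundedCurvePartner (hp3 : p = 3)
    (hJ : thm62_63_73_signedColemanKato_zetaJoint) (h12 : thm12_signedSelmerDual_finite_torsion)
    (h41 : thm41_signedCharIdeal_divisibility)
    (h5 : realPeriodRat_eq_unit_mul_plusPeriod) (h3 : realPeriodRat_eq_unit_mul_plusPeriod_three)
    (hD : Hida2000_thm326_exists_galoisRep) (hC : Carayol1986_artinConductorExponent)
    (hS : ∀ (V : WeierstrassCurve ℚ) (ℓ : ℕ) [Fact ℓ.Prime],
      V.swanConductorAt_rationalTate_eq_wildConductorExponent_of_ringChar_eq_two ℓ)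
    (hmod : exists_isNewformOf)
    (hKim : BDKim2009.cor213_signedLambda_add_sum_delta_eq_of_torsionIso) (hV : vatsal1999_plusSymbol_congruence)
    (hX : ClassX7 W p) (hap : W.frobeniusTrace p = 0) (hs : ¬ Surj W p)
    (hgoodA : A.HasGoodReductionAtPrime p) (hapA : A.frobeniusTrace p = 0)
    (he : ∃ e : geomTorsion W (p : ℤ) ≃+ geomTorsion A (p : ℤ),
      ∀ (σ : absoluteGaloisGroup ℚ) (P : geomTorsion W (p : ℤ)), e (σ • P) = σ • e P)
    (hbound : ∀ (ε : ℤˣ), ∀ [NeZero (A.conductorNorm ℤ)] (g : CuspForm (Gamma0 (A.conductorNorm ℤ)) 2), IsNewformOf A g →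
      ∀ (κ : ZpExtension ℚ p) (γ : absoluteGaloisGroup ℚ), κ.IsCyclotomic → κ.IsTopGenerator γ → IsCyclotomicVariable p γ →
      ∀ (Lp Lm : IwasawaAlgebra p), IsPollackPair g p Lp Lm →
        ∀ (DA : SignedSelmerDualData A κ γ ε) [Module.Finite (IwasawaAlgebra p) DA.X],
          Module.IsTorsion (IwasawaAlgebra p) DA.X → lam (kobayashiL ε Lp Lm) ≤ lambdaInvariant p DA.X) :
    ∀ ε : ℤˣ, KobayashiLowerDivisibility W p ε := by
  have hp : p ≠ 2 := by omega
  exact forall_kobayashiLowerDivisibility_three_of_lamTransport_le W p hp3 hJ h12 h41 h5 h3 hX hap hs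
    (fun ε κ γ hκ hγ hγ' _ f hf ϖ hϖ Lplus Lminus hPP hfl D _ hXt hμ G m hG ↦
      lamTransport_le_of_boundedCurvePartner W A p h12 hD hC hS hmod hKim hV hp hX hap hgoodA hapA he ε
        (fun g hg ↦ hbound ε g hg) κ γ hκ hγ hγ' f hf ϖ hϖ Lplus Lminus hPP hfl D hXt hμ G m hG)

/-- ★ **TIER T1b AT ANY ODD `p` MODULO PRINT, THE PARTNER BOUND AT `ε = −1` AND ONE ODD MAZUR–TATE ROW OF `W`**: crux L's body
`∀ ε, KobayashiLowerDivisibility W p ε` at a small-image supersingular X7 pair with a curve partner `A` bounded at the sign `−1`, the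
floor of `W` at `ε₀ = −1` being read off ONE displayed odd row (`θ_n(f) = Θ ∈ Λ`, `Θ ≠ 0`, `μ(Θ) = 0`, `λ(Θ) = deg ω_n^+ + l`; file
`…RttFloorCert` §2). Eleven published named facts (no Pollack–Rubin). Per pair; CONDITIONAL; closes nothing class-wide.
[cite: Kobayashi2003, Conjecture (p. 2), Thm. 7.4 (p. 13)] [cite: Pollack2003, Prop. 6.18, Conj. 6.3] [cite: BDKim2009, Cor. 2.13]
[cite: Vatsal1999, Thm. (1.6), (1.13)] [cite: GreenbergLNM1716, §3 Lemma 3.1] -/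
theorem forall_kobayashiLowerDivisibility_of_boundedCurvePartner_of_mazurTateRowOdd
    (hJ : thm62_63_73_signedColemanKato_zetaJoint) (h12 : thm12_signedSelmerDual_finite_torsion)
    (h41 : thm41_signedCharIdeal_divisibility)
    (h5 : realPeriodRat_eq_unit_mul_plusPeriod) (h3 : realPeriodRat_eq_unit_mul_plusPeriod_three)
    (hD : Hida2000_thm326_exists_galoisRep) (hC : Carayol1986_artinConductorExponent)
    (hS : ∀ (V : WeierstrassCurve ℚ) (ℓ : ℕ) [Fact ℓ.Prime],
      V.swanConductorAt_rationalTate_eq_wildConductorExponent_of_ringChar_eq_two ℓ)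
    (hmod : exists_isNewformOf)
    (hKim : BDKim2009.cor213_signedLambda_add_sum_delta_eq_of_torsionIso) (hV : vatsal1999_plusSymbol_congruence)
    (hp : p ≠ 2) (hX : ClassX7 W p) (hap : W.frobeniusTrace p = 0) (hs : ¬ Surj W p)
    (hgoodA : A.HasGoodReductionAtPrime p) (hapA : A.frobeniusTrace p = 0)
    (he : ∃ e : geomTorsion W (p : ℤ) ≃+ geomTorsion A (p : ℤ),
      ∀ (σ : absoluteGaloisGroup ℚ) (P : geomTorsion W (p : ℤ)), e (σ • P) = σ • e P)
    (hbound : ∀ [NeZero (A.conductorNorm ℤ)] (g : CuspForm (Gamma0 (A.conductorNorm ℤ)) 2), IsNewformOf A g →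
      ∀ (κ : ZpExtension ℚ p) (γ : absoluteGaloisGroup ℚ), κ.IsCyclotomic → κ.IsTopGenerator γ → IsCyclotomicVariable p γ →
      ∀ (Lp Lm : IwasawaAlgebra p), IsPollackPair g p Lp Lm →
        ∀ (DA : SignedSelmerDualData A κ γ (-1)) [Module.Finite (IwasawaAlgebra p) DA.X],
          Module.IsTorsion (IwasawaAlgebra p) DA.X → lam (kobayashiL (-1) Lp Lm) ≤ lambdaInvariant p DA.X)
    {n : ℕ} (hn : Odd n) {l : ℕ}
    (hrow : ∀ [NeZero (W.conductorNorm ℤ)] (f : CuspForm (Gamma0 (W.conductorNorm ℤ)) 2), IsNewformOf W f →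
      ∃ Θ : IwasawaAlgebra p, iwasawaToPowerSeries p Θ =
          ((mazurTateElement f p n).map (algebraMap ℚ ℚ_[p]) : PowerSeries ℚ_[p]) ∧
        Θ ≠ 0 ∧ mu Θ = 0 ∧ lam Θ = (cyclotomicOmegaPlus p n).natDegree + l) :
    ∀ ε : ℤˣ, KobayashiLowerDivisibility W p ε := by
  have hfl : ∀ [NeZero (W.conductorNorm ℤ)] (f : CuspForm (Gamma0 (W.conductorNorm ℤ)) 2), IsNewformOf W f →
      ∀ Lplus Lminus : IwasawaAlgebra p, IsPollackPair f p Lplus Lminus →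
        HasUnitContent (kobayashiL (-1) Lplus Lminus) :=
    fun f hf Lplus Lminus hPP ↦ oneSignFloor_of_mazurTateRowOdd W p hp hX.1.1 hap hn hrow f hf Lplus Lminus hPP
  have hMC : KobayashiMainConjecture W p (-1) :=
    kobayashiMainConjecture_of_lamTransport_le W p hp (thm62_63_73_signedColemanKato_zeta_of_joint hJ) h12 h41 h5 h3
      hX.1.1 hap hs (-1) (fun f hf Lplus Lminus hPP ↦ hfl f hf Lplus Lminus hPP)
      (fun κ γ hκ hγ hγ' _ f hf ϖ hϖ Lplus Lminus hPP D _ hXt hμ G m hG ↦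
        lamTransport_le_of_boundedCurvePartner W A p h12 hD hC hS hmod hKim hV hp hX hap hgoodA hapA he (-1) hbound
          κ γ hκ hγ hγ' f hf ϖ hϖ Lplus Lminus hPP (hfl f hf Lplus Lminus hPP) D hXt hμ G m hG)
  exact fun ε ↦ (SignDefect.X7.exists_kobayashiLowerDivisibility_iff_forall W p h12 h5 h3 hJ hp hX hap).mp
    ⟨-1, kobayashiLowerDivisibility_of_mainConjecture hMC⟩ ε

/-- ★ **RECORDS-READY: crux L's body at a pair with a RANK DONOR, any odd `p`, from print + THREE displayed finite data** — `W`'s odd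
Mazur–Tate row (`n`, `μ(θ_n(f)) = 0`, `λ(θ_n(f)) = deg ω_n^+ + l`: the floor), the donor `A`'s odd row (`n'`, `μ(θ_{n'}(g)) = 0`,
`λ(θ_{n'}(g)) = deg ω_{n'}^+ + l_A`: `λ(L^−_p(A)) = l_A`) and `l_A ≤ rank A(ℚ)` (independent points). `A` is ANY curve good at `p` with
`a_p(A) = 0` and `W[p] ≃ A[p]` equivariantly (kernel Hesse certificate at `p = 3, 5`). Eleven published named facts; NO Pollack–Rubin, NO
`L`-value, NO CM. Per pair; CONDITIONAL; closes nothing class-wide. [cite: Kobayashi2003, Conjecture (p. 2), Thm. 1.2, Thm. 7.4]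
[cite: GreenbergLNM1716, §3 Lemma 3.1] [cite: Pollack2003, Prop. 6.9, 6.10, 6.18] [cite: BDKim2009, Cor. 2.13] [cite: Vatsal1999, (1.6), (1.13)] -/
theorem forall_kobayashiLowerDivisibility_of_rankDonor_of_mazurTateRowOdd
    (hJ : thm62_63_73_signedColemanKato_zetaJoint) (h12 : thm12_signedSelmerDual_finite_torsion)
    (h41 : thm41_signedCharIdeal_divisibility)
    (h5 : realPeriodRat_eq_unit_mul_plusPeriod) (h3 : realPeriodRat_eq_unit_mul_plusPeriod_three)
    (hD : Hida2000_thm326_exists_galoisRep) (hC : Carayol1986_artinConductorExponent)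
    (hS : ∀ (V : WeierstrassCurve ℚ) (ℓ : ℕ) [Fact ℓ.Prime],
      V.swanConductorAt_rationalTate_eq_wildConductorExponent_of_ringChar_eq_two ℓ)
    (hmod : exists_isNewformOf)
    (hKim : BDKim2009.cor213_signedLambda_add_sum_delta_eq_of_torsionIso) (hV : vatsal1999_plusSymbol_congruence)
    (hp : p ≠ 2) (hX : ClassX7 W p) (hap : W.frobeniusTrace p = 0) (hs : ¬ Surj W p)
    (hgoodA : A.HasGoodReductionAtPrime p) (hapA : A.frobeniusTrace p = 0)
    (he : ∃ e : geomTorsion W (p : ℤ) ≃+ geomTorsion A (p : ℤ),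
      ∀ (σ : absoluteGaloisGroup ℚ) (P : geomTorsion W (p : ℤ)), e (σ • P) = σ • e P)
    {n' : ℕ} (hn' : Odd n') {lA : ℕ}
    (hrowA : ∀ [NeZero (A.conductorNorm ℤ)] (g : CuspForm (Gamma0 (A.conductorNorm ℤ)) 2), IsNewformOf A g →
      ∃ Θ : IwasawaAlgebra p, iwasawaToPowerSeries p Θ =
          ((mazurTateElement g p n').map (algebraMap ℚ ℚ_[p]) : PowerSeries ℚ_[p]) ∧
        Θ ≠ 0 ∧ mu Θ = 0 ∧ lam Θ = (cyclotomicOmegaPlus p n').natDegree + lA)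
    (hr : lA ≤ A.mordellWeilRank)
    {n : ℕ} (hn : Odd n) {l : ℕ}
    (hrow : ∀ [NeZero (W.conductorNorm ℤ)] (f : CuspForm (Gamma0 (W.conductorNorm ℤ)) 2), IsNewformOf W f →
      ∃ Θ : IwasawaAlgebra p, iwasawaToPowerSeries p Θ =
          ((mazurTateElement f p n).map (algebraMap ℚ ℚ_[p]) : PowerSeries ℚ_[p]) ∧
        Θ ≠ 0 ∧ mu Θ = 0 ∧ lam Θ = (cyclotomicOmegaPlus p n).natDegree + l) :
    ∀ ε : ℤˣ, KobayashiLowerDivisibility W p ε := by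
  have hne : (-1 : ℤˣ) ≠ 1 := by decide
  refine forall_kobayashiLowerDivisibility_of_boundedCurvePartner_of_mazurTateRowOdd W A p hJ h12 h41 h5 h3 hD hC hS hmod hKim hV
    hp hX hap hs hgoodA hapA he ?_ hn hrow
  intro _ g hg κ γ hκ hγ hγ' Lp Lm hPP DA _ hXtA
  obtain ⟨Θ, hΘ, hΘ0, hμ, hlam⟩ := hrowA g hg
  exact partnerBound_of_mazurTateRow_of_le_mordellWeilRank A p hp hgoodA hapA hg (-1)
    ⟨fun h ↦ absurd hn' (Nat.not_odd_iff_even.mpr h), fun h ↦ absurd h hne⟩ hΘ hΘ0 hμ (by rwa [if_neg hne]) hr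
    κ γ hκ hγ hγ' Lp Lm hPP DA hXtA

end TierBounded

end Summit.BirchSwinnertonDyer.BirchSwinnertonDyer.Theorems.SmallImageRttOneSided

end
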